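import Summits.BirchSwinnertonDyer.BirchSwinnertonDyer.Theorems.SchneiderFreeAdditiveX3PotMultReadHyps
import Summits.BirchSwinnertonDyer.BirchSwinnertonDyer.Theorems.SchneiderFreeAdditiveX3PotMultReadHypsOriented
import HarnessLib
import HarnessLib.Audit.Tags

/-!
# Route `SchneiderFreeAdditiveX3` (K1 door), SECOND WING on the (M) cell — SHORT NAME for the ONE
# frame-level input of the (M) co-socket record: `PotMultRead.KYCHMUnit` (= door-c2's `KYCHM` REVERSED,
# with a UNIT cofactor)

Cell `bsd-schneider-ideate` (HOME `run/shared/lean/pub/bsd-schneider-ideate/`), seat `door-c5` gen 10.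
PARTITION: board row B6 ∩ X3 ∩ sst-twist, `r = 1`, (M) half (X3 ∧ (M), 4 541 of 7 101 pairs) of
`Rank1Residual.partition`; types-the-object-of the co-H-record of the sibling route's crux r4
`PotMultBranchCoIMC` (the UPPER co-socket `Upper.AdditiveIMCUpperBDPInputManinAt` on SubM; one-line
signature proved in this seat's `…UpperCoSocketOfKYCHM.lean`); closes nothing (BSD is not advanced). The
(M) twin of this seat's gen-9 `…UpperKYReadHyps.lean` (`KYRead.KYReadCHUnit`) and the upward twin of
door-c2 gen 9's `…PotMultReadHyps.lean` (`PotMultRead.KYCHM`).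

Statement only — ONE predicate WITH BODY; nothing is asserted about elliptic curves. The body is VERBATIM
the binder pair `(h3, h2)` of this seat's `Upper.potMult_additiveIMCUpperBDPOnTreeLeAt_of_valueAt_twisted_of_facts`
(`…UpperPotMultRebaseFacts.lean`) quantified over the (M) cell's socket data exactly as `KYCHM` is, and
differs from `KYCHM` in exactly TWO tokens:

* the divisibility is REVERSED — `(L) ⊆ Ch_Λ(X_ac^∅(W_K))·R₀⟦T⟧` (the Kolyvagin / Euler-system half of the
  branch main conjecture for the multiplicative Eisenstein partner `f_V` on the `χ_ε`-branch of conductor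
  `p`, `p ∥ N_V`), where `KYCHM` has `⊇` (the Eisenstein-congruence half);
* the cofactor of the conductor-`p` VALUE FORMULA `L(0) = u·(log_ω Q / c_V)²` at the descended
  `χ_ε`-twisted conductor-`p` Heegner point `Q` is a UNIT `u ∈ R₀ˣ` (genuinely needed upward — door-c5 gen 8
  FINDING; downward any integral `u` works).

DUALITY (kernel-checked on both cells): LOWER record = {branch `⊇`-half, any integral cofactor}
(door-c2's `KYCHM` ⟹ crux r2 `PotMultBranchIMC`); UPPER record = {branch `⊆`-half, UNIT cofactor}
(`KYCHMUnit` ⟹ the wing's `hCoM`). HONEST FRAMING: on the (M) cell NEITHER half of that branch main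
conjecture NOR the conductor-`p` `p`-adic value formula at `p ∥ N_V` is in print (door-c2's «find» verdict
×9: Keller–Yin arXiv:2410.23241 p. 15 names the multiplicative `χ_ε`-branch open; arXiv:2402.12781 §5
Thm. 5.0.4 is the TRIVIAL branch only; Castella–Hsieh 2018 Thm. 5.7 needs `p ∤ N`; Castella's exceptional
specialisations of big Heegner points treat `p ∥ N` at characters UNRAMIFIED at `p`) — this is a
RESEARCH-shaped hypothesis of the wing, conjecture-tagged (an obligation node, nothing asserted), exactly
like `KYCHM`. Theses-free (imports only Theorems defs / Literature), so a route file may import it.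

ADDENDUM (same generation, appended): door-c2 gen 9's FINDING §2b showed the un-oriented `KYCHM` — and hence
`KYCHMUnit` above, which copies its quantification — OVER-STRONG: the value clause is asked for EVERY `β : ℤ`,
and at a NON-orientation (`4 N_V ∤ β² − d_K`) the tree's total `heegnerPointOfConductor d_K β p` is a CM point
of a junk discriminant, where the clause can fire with an unrelated (even torsion) `Q`. Door-c2 repaired the
door's input as `PotMultRead.KYCHMOriented` (p496004: the clause restricted to orientations
`4 * (V.conductorNorm ℤ : ℤ) ∣ β ^ 2 - NumberField.discr K`, exactly what the road instantiates). The wing's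
input is repaired identically BELOW as `KYCHMUnitOriented` (= `KYCHMOriented` REVERSED with a UNIT cofactor);
`KYCHMUnit` is kept byte-identical (append-only protocol) and is SUPERSEDED — no theorem of the tree consumes
it; every (M) co-socket record of this seat is keyed to `KYCHMUnitOriented`.

References: Keller–Yin arXiv:2410.23241 §3.4–3.5, p. 15; Keller–Yin arXiv:2402.12781 §5 Thm. 5.0.4;
Castella–Hsieh, Math. Ann. 370 (2018) Thm. 5.7, Lemma 5.4; Castella, J. Inst. Math. Jussieu 17 (2018)
(exceptional specialisations; shape at `p ∥ N`); Cai–Shu–Tian, ANT 8 (2014) Thm. 1.5; Darmon 2004 Thm. 3.6.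
-/

noncomputable section

open scoped Classical

open WeierstrassCurve NumberField IsDedekindDomain Field
  Literature.NumberTheory.EllipticCurves
  Literature.NumberTheory.EllipticCurves.CaiShuTian2014
  Literature.NumberTheory.EllipticCurves.ModularForms
  Literature.NumberTheory.EllipticCurves.GreenbergSelmer
  Literature.NumberTheory.EllipticCurves.Rank1Residual
  Literature.NumberTheory.GaloisRepresentations
  Literature.NumberTheory.GaloisCohomology
  Summit.BirchSwinnertonDyer.Rank1Residual
  Summit.BirchSwinnertonDyer.Rank1Residual.X11b
  Summit.BirchSwinnertonDyer.Rank1Residual.X11b.AcSelmer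
  Summit.BirchSwinnertonDyer.Rank1Residual.X11b.Halves

-- D-0017 layout: summit = sub-problem, so `Summit.BirchSwinnertonDyer.BirchSwinnertonDyer.…` is the
-- mandated namespace (same option as the route's sockets files).
set_option linter.dupNamespace false
set_option autoImplicit false

namespace Summit.BirchSwinnertonDyer.BirchSwinnertonDyer.Theorems.SchneiderFree.PotMultRead

/-- **`KYCHMUnit` — the ONE frame-level input of the (M) CO-socket record (binders `h3`, `h2` of
`Upper.potMult_additiveIMCUpperBDPOnTreeLeAt_of_valueAt_twisted_of_facts`, quantified VERBATIM as in
`KYCHM`).** At every presented socket datum `(N, K, Dt, H, ι, P)` of a door curve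
`W = C₂ • ((D • V) ⊗ χ_{p*})` on the (M) cell (`Mult V p`, `r_an(W) = 1`, `p ≠ 2`, N10 locus, `K` Heegner
with odd `d_K`, `p ∤ #𝓞_K^×`, `L(W^{d_K},1) ≠ 0`, `P` the traced Heegner point, non-torsion) and every
anticyclotomic frame `(κ, γ, 𝔭)` with `𝔭 ∣ p` of degree one, for every parametrisation datum `Dt_V` of the
partner: a series `L ∈ R₀⟦T⟧` and a UNIT `u ∈ R₀ˣ` with (co-h3|M) `(L) ⊆ Ch_Λ(X_ac^∅(W_K))·R₀⟦T⟧` and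
(h2|M) `L(0) = u·(log_ω Q / c_V)²` at the descended `χ_ε`-twisted conductor-`p` Heegner point `Q ∈ W(K)`
(for any orientation `β`, any `K[p]`-point `y` of `V` over `y(p)`, any genus datum `θ`, `s`). `KYCHM` with
the divisibility REVERSED (Kolyvagin / Euler-system half) and the cofactor a UNIT. RESEARCH — neither the
branch main conjecture for the multiplicative Eisenstein partner on the `χ_ε`-branch nor the conductor-`p`
`p`-adic value formula at `p ∥ N_V` is in print; a predicate, conjecture-tagged, nothing asserted.
[cite: KellerYin2024b, §3.4–3.5 and p. 15 (arXiv:2410.23241) (shape; preprint; names the case open)]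
[cite: CastellaHsieh2018, Thm. 5.7 and Lemma 5.4 (shape of the value formula at p ∤ N)] -/
@[conjecture]
def KYCHMUnit : Prop :=
  ∀ (p : ℕ) [Fact p.Prime] (V : WeierstrassCurve ℚ) [V.IsElliptic] [V.IsGloballyMinimal]
      [NeZero (V.conductorNorm ℤ)] (D C₂ : VariableChange ℚ) [(D • V).IsCharNeTwoNF]
      [(C₂ • (D • V).quadraticTwist ((-1 : ℚ) ^ (p / 2) * p)).IsElliptic]
      [(C₂ • (D • V).quadraticTwist ((-1 : ℚ) ^ (p / 2) * p)).IsGloballyMinimal]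
      (N : ℕ) [NeZero N] (K : Type) [Field K] [NumberField K]
      (Dt : ModularParametrizationData (C₂ • (D • V).quadraticTwist ((-1 : ℚ) ^ (p / 2) * p)) N)
      (H : HeegnerDatum N (NumberField.discr K)) (ι : K →+* ℂ)
      (P : ((C₂ • (D • V).quadraticTwist ((-1 : ℚ) ^ (p / 2) * p)).baseChange K).toAffine.Point),
      (C₂ • (D • V).quadraticTwist ((-1 : ℚ) ^ (p / 2) * p)).analyticRank = 1 →
      Additive.N10.Locus (C₂ • (D • V).quadraticTwist ((-1 : ℚ) ^ (p / 2) * p)) p →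
      (C₂ • (D • V).quadraticTwist ((-1 : ℚ) ^ (p / 2) * p)).conductorNorm ℤ = N →
      IsImaginaryQuadratic K → Odd (NumberField.discr K) → ¬ p ∣ Units.torsionOrder K →
      SatisfiesHeegnerHypothesis N K →
      ((C₂ • (D • V).quadraticTwist ((-1 : ℚ) ^ (p / 2) * p)).quadraticTwist
        (NumberField.discr K : ℚ)).entireLFunction 1 ≠ 0 →
      WeierstrassCurve.Affine.Point.map ι.toRatAlgHom P = heegnerPointComplex Dt H →
      ¬ IsOfFinAddOrder P → p ≠ 2 → Mult V p →
      ∀ (κ : ZpExtension K p), κ.IsAnticyclotomic →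
      ∀ (γ : Field.absoluteGaloisGroup K) [Fact (κ.IsTopGenerator γ)]
        (𝔭 : HeightOneSpectrum (𝓞 K)) (h𝔭 : ((p : ℕ) : 𝓞 K) ∈ 𝔭.asIdeal)
        (he : 𝔭.asIdeal.ramificationIdx (𝓞 ℚ) = 1) (hf : 𝔭.asIdeal.inertiaDeg (𝓞 ℚ) = 1),
      ∀ [NumberField (ringClassField K ι p)]
        (DtV : ModularParametrizationData V (V.conductorNorm ℤ)),
      ∃ (L : UnrSeries p) (u : (unrIntegers p)ˣ),
        Ideal.span {L} ≤
          (XAc.charIdeal ((C₂ • (D • V).quadraticTwist ((-1 : ℚ) ^ (p / 2) * p)).baseChange K)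
            p κ 𝔭 ∅ γ).map (PowerSeries.map (toUnr p)) ∧
        ∀ (β : ℤ) (y : (V.baseChange (ringClassField K ι p : Type)).toAffine.Point),
          WeierstrassCurve.Affine.Point.map (ringClassField K ι p).subtype.toRatAlgHom y =
            heegnerPointComplexOfConductor DtV (NumberField.discr K) β p →
          ∀ (θ : ringClassField K ι p)
            (hθ2 : θ ^ 2 = algebraMap ℚ (ringClassField K ι p) ((-1 : ℚ) ^ (p / 2) * p))
            (hθ : θ ≠ 0) (s : ringClassGal ι p → ℤˣ),
          (∀ σ : ringClassGal ι p, σ.1 θ = ((s σ : ℤ) : ringClassField K ι p) * θ) →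
          ∀ Q : ((C₂ • (D • V).quadraticTwist ((-1 : ℚ) ^ (p / 2) * p)).baseChange K).toAffine.Point,
          Affine.Point.map (algebraMap K (ringClassField K ι p)).toRatAlgHom Q =
            VariableChange.pointEquivBaseChange ((D • V).quadraticTwist ((-1 : ℚ) ^ (p / 2) * p)) C₂
              (ringClassField K ι p)
              ((VariableChange.pointEquiv (((D • V).quadraticTwist
                  ((-1 : ℚ) ^ (p / 2) * p)).baseChange (ringClassField K ι p : Type))
                  (untwistAt hθ)).symm
                ((Affine.Point.congrEquiv (untwistAt_smul_eq (D • V) hθ2 hθ)).symm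
                  (VariableChange.pointEquivBaseChange V D (ringClassField K ι p)
                    (∑ τ : ringClassGal ι p,
                      (s τ : ℤ) • pointGalHom V (ringClassField K ι p : Type) τ.1 y)))) →
          L.HasValueAt 0 ((((u : unrIntegers p)) : ℂ_[p]) *
            (algebraMap ℚ_[p] ℂ_[p] (logOmega (C₂ • (D • V).quadraticTwist ((-1 : ℚ) ^ (p / 2) * p))
              p (embAt K p 𝔭 h𝔭 he hf) Q / (DtV.c : ℚ_[p]))) ^ 2)

/-- **`KYCHMUnitOriented` — the ONE frame-level input of the (M) CO-socket record, HONEST (oriented) form: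
door-c2's `KYCHMOriented` (p496004) REVERSED with a UNIT cofactor; supersedes `KYCHMUnit`.** At every presented
socket datum `(N, K, Dt, H, ι, P)` of a door curve `W = C₂ • ((D • V) ⊗ χ_{p*})` on the (M) cell (`Mult V p`,
`r_an(W) = 1`, `p ≠ 2`, N10 locus, `K` Heegner with odd `d_K`, `p ∤ #𝓞_K^×`, `L(W^{d_K},1) ≠ 0`, `P` the traced
Heegner point, non-torsion) and every anticyclotomic frame `(κ, γ, 𝔭)` with `𝔭 ∣ p` of degree one, for every
parametrisation datum `Dt_V` of the partner: a series `L ∈ R₀⟦T⟧` and a UNIT `u ∈ R₀ˣ` with (co-h3|M)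
`(L) ⊆ Ch_Λ(X_ac^∅(W_K))·R₀⟦T⟧` (the Kolyvagin / Euler-system half of the branch main conjecture for the
multiplicative Eisenstein partner on the `χ_ε`-branch) and (h2|M) `L(0) = u·(log_ω Q / c_V)²` at the descended
`χ_ε`-twisted conductor-`p` Heegner point `Q ∈ W(K)` built from ANY ORIENTATION `β` (`4 N_V ∣ β² − d_K`), the
`K[p]`-point `y` of `V` over `y_β(p)`, and any genus datum `θ`, `s`. VERBATIM the binders `h3`, `h2` of
`Upper.potMult_additiveIMCUpperBDPOnTreeLeAt_of_valueAt_twisted_of_facts` (`…UpperPotMultRebaseFacts.lean`).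
RESEARCH — neither half of that branch main conjecture nor the conductor-`p` `p`-adic value formula at `p ∥ N_V`
is in print; a predicate, conjecture-tagged, nothing asserted.
[cite: KellerYin2024b, §3.4–3.5 and p. 15 (arXiv:2410.23241) (shape; preprint; names the case open)]
[cite: CastellaHsieh2018, Thm. 5.7 and Lemma 5.4 (shape of the value formula at p ∤ N)]
[cite: GrossLMS1991, §3 (orientations β mod 2N of Heegner points of conductor n)] -/
@[conjecture]
def KYCHMUnitOriented : Prop :=
  ∀ (p : ℕ) [Fact p.Prime] (V : WeierstrassCurve ℚ) [V.IsElliptic] [V.IsGloballyMinimal]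
      [NeZero (V.conductorNorm ℤ)] (D C₂ : VariableChange ℚ) [(D • V).IsCharNeTwoNF]
      [(C₂ • (D • V).quadraticTwist ((-1 : ℚ) ^ (p / 2) * p)).IsElliptic]
      [(C₂ • (D • V).quadraticTwist ((-1 : ℚ) ^ (p / 2) * p)).IsGloballyMinimal]
      (N : ℕ) [NeZero N] (K : Type) [Field K] [NumberField K]
      (Dt : ModularParametrizationData (C₂ • (D • V).quadraticTwist ((-1 : ℚ) ^ (p / 2) * p)) N)
      (H : HeegnerDatum N (NumberField.discr K)) (ι : K →+* ℂ)
      (P : ((C₂ • (D • V).quadraticTwist ((-1 : ℚ) ^ (p / 2) * p)).baseChange K).toAffine.Point),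
      (C₂ • (D • V).quadraticTwist ((-1 : ℚ) ^ (p / 2) * p)).analyticRank = 1 →
      Additive.N10.Locus (C₂ • (D • V).quadraticTwist ((-1 : ℚ) ^ (p / 2) * p)) p →
      (C₂ • (D • V).quadraticTwist ((-1 : ℚ) ^ (p / 2) * p)).conductorNorm ℤ = N →
      IsImaginaryQuadratic K → Odd (NumberField.discr K) → ¬ p ∣ Units.torsionOrder K →
      SatisfiesHeegnerHypothesis N K →
      ((C₂ • (D • V).quadraticTwist ((-1 : ℚ) ^ (p / 2) * p)).quadraticTwist
        (NumberField.discr K : ℚ)).entireLFunction 1 ≠ 0 →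
      WeierstrassCurve.Affine.Point.map ι.toRatAlgHom P = heegnerPointComplex Dt H →
      ¬ IsOfFinAddOrder P → p ≠ 2 → Mult V p →
      ∀ (κ : ZpExtension K p), κ.IsAnticyclotomic →
      ∀ (γ : Field.absoluteGaloisGroup K) [Fact (κ.IsTopGenerator γ)]
        (𝔭 : HeightOneSpectrum (𝓞 K)) (h𝔭 : ((p : ℕ) : 𝓞 K) ∈ 𝔭.asIdeal)
        (he : 𝔭.asIdeal.ramificationIdx (𝓞 ℚ) = 1) (hf : 𝔭.asIdeal.inertiaDeg (𝓞 ℚ) = 1),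
      ∀ [NumberField (ringClassField K ι p)]
        (DtV : ModularParametrizationData V (V.conductorNorm ℤ)),
      ∃ (L : UnrSeries p) (u : (unrIntegers p)ˣ),
        Ideal.span {L} ≤
          (XAc.charIdeal ((C₂ • (D • V).quadraticTwist ((-1 : ℚ) ^ (p / 2) * p)).baseChange K)
            p κ 𝔭 ∅ γ).map (PowerSeries.map (toUnr p)) ∧
        ∀ (β : ℤ), 4 * (V.conductorNorm ℤ : ℤ) ∣ β ^ 2 - NumberField.discr K →
        ∀ (y : (V.baseChange (ringClassField K ι p : Type)).toAffine.Point),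
          WeierstrassCurve.Affine.Point.map (ringClassField K ι p).subtype.toRatAlgHom y =
            heegnerPointComplexOfConductor DtV (NumberField.discr K) β p →
          ∀ (θ : ringClassField K ι p)
            (hθ2 : θ ^ 2 = algebraMap ℚ (ringClassField K ι p) ((-1 : ℚ) ^ (p / 2) * p))
            (hθ : θ ≠ 0) (s : ringClassGal ι p → ℤˣ),
          (∀ σ : ringClassGal ι p, σ.1 θ = ((s σ : ℤ) : ringClassField K ι p) * θ) →
          ∀ Q : ((C₂ • (D • V).quadraticTwist ((-1 : ℚ) ^ (p / 2) * p)).baseChange K).toAffine.Point,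
          Affine.Point.map (algebraMap K (ringClassField K ι p)).toRatAlgHom Q =
            VariableChange.pointEquivBaseChange ((D • V).quadraticTwist ((-1 : ℚ) ^ (p / 2) * p)) C₂
              (ringClassField K ι p)
              ((VariableChange.pointEquiv (((D • V).quadraticTwist
                  ((-1 : ℚ) ^ (p / 2) * p)).baseChange (ringClassField K ι p : Type))
                  (untwistAt hθ)).symm
                ((Affine.Point.congrEquiv (untwistAt_smul_eq (D • V) hθ2 hθ)).symm
                  (VariableChange.pointEquivBaseChange V D (ringClassField K ι p)
                    (∑ τ : ringClassGal ι p,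
                      (s τ : ℤ) • pointGalHom V (ringClassField K ι p : Type) τ.1 y)))) →
          L.HasValueAt 0 ((((u : unrIntegers p)) : ℂ_[p]) *
            (algebraMap ℚ_[p] ℂ_[p] (logOmega (C₂ • (D • V).quadraticTwist ((-1 : ℚ) ^ (p / 2) * p))
              p (embAt K p 𝔭 h𝔭 he hf) Q / (DtV.c : ℚ_[p]))) ^ 2)

end Summit.BirchSwinnertonDyer.BirchSwinnertonDyer.Theorems.SchneiderFree.PotMultRead

end
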